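import Summits.KontsevichZagierPeriods.KontsevichZagierPeriods.Theorems.LinRedNormalFormArrangementNormalFormSeparateThreeHICone
import Summits.KontsevichZagierPeriods.KontsevichZagierPeriods.Theorems.LinRedNormalFormArrangementNormalFormSeparateThreeHITonelli

/-!
# The cone fibres at a rim vertex on the pole plane

(Line `janus-bands`, crux `ArrangementNormalForm`, stub `stub_separateThreeZero`, part `HIFibres` of
the termwise numerator split `separateThree_hI` under the rim condition.)

At a point `(v₀, 0)` of the closed cell whose closed vertical fibre is the single point `{0}` (a
RIM point on the pole plane) the vertical fibres of the cell over nearby base points `v₀ + u` are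
the fibres of the local cone: `Kfib u = {t | every active constraint is positive at (u, t)}`
(`fib_eq_Kfib`, registered as `separateThree_fibres`). In terms of the heights `hgt` of the active
non-vertical constraints, `Kfib u` is the interval `(hlo u, hhi u)` (largest bottom height, least
top height) when the active vertical constraints admit `u`, and empty otherwise (`mem_Kfib_iff`);
`hlo`, `hhi` are continuous and positively homogeneous, the cone fibres have length `O(‖u‖)`
(`Kfib_subset`), and — the cell lying above the pole plane — a non-empty cone fibre starts at a
non-negative height (`hlo_nonneg`).
-/

noncomputable section

open Set Filter Topology

namespace Summit.KontsevichZagierPeriods.ArrangementNormalForm.JanusBands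

namespace SepThree

/-! ### Heights of constraints over the base plane -/

/-- The base-linear part of a constraint. -/
def blin (t : Con) (u : Fin 2 → ℝ) : ℝ := t.1 0 * u 0 + t.1 1 * u 1

/-- The height of a non-vertical linear constraint over the base displacement `u`. -/
def hgt (t : Con) (u : Fin 2 → ℝ) : ℝ := -blin t u / t.2.1

/-- The linear part in terms of the base-linear part. -/
theorem clin_eq (t : Con) (u : Fin 2 → ℝ) (w : ℝ) : clin t (u, w) = blin t u + t.2.1 * w := rfl

/-- A non-vertical linear constraint factors through its height. -/
theorem clin_eq_mul_sub (t : Con) (u : Fin 2 → ℝ) (w : ℝ) (hc : t.2.1 ≠ 0) :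
    clin t (u, w) = t.2.1 * (w - hgt t u) := by
  rw [clin_eq, hgt]
  field_simp
  ring

/-- The base-linear part is linear. -/
theorem blin_smul (t : Con) (s : ℝ) (u : Fin 2 → ℝ) : blin t (s • u) = s * blin t u := by
  simp only [blin, Pi.smul_apply, smul_eq_mul]; ring

/-- The height is positively (indeed linearly) homogeneous. -/
theorem hgt_smul (t : Con) (s : ℝ) (u : Fin 2 → ℝ) : hgt t (s • u) = s * hgt t u := by
  simp only [hgt, blin_smul]; ring

/-- The base-linear part is continuous. -/
theorem continuous_blin (t : Con) : Continuous (blin t) := by unfold blin; fun_prop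

/-- The height is continuous. -/
theorem continuous_hgt (t : Con) : Continuous (hgt t) := by unfold hgt blin; fun_prop

/-- The Lipschitz bound of the base-linear part. -/
theorem abs_blin_le (t : Con) (u : Fin 2 → ℝ) : |blin t u| ≤ (|t.1 0| + |t.1 1|) * ‖u‖ := by
  unfold blin
  have h0 : |u 0| ≤ ‖u‖ := by rw [← Real.norm_eq_abs]; exact norm_le_pi_norm u 0
  have h1 : |u 1| ≤ ‖u‖ := by rw [← Real.norm_eq_abs]; exact norm_le_pi_norm u 1
  calc |t.1 0 * u 0 + t.1 1 * u 1| ≤ |t.1 0 * u 0| + |t.1 1 * u 1| := abs_add_le _ _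
    _ = |t.1 0| * |u 0| + |t.1 1| * |u 1| := by rw [abs_mul, abs_mul]
    _ ≤ |t.1 0| * ‖u‖ + |t.1 1| * ‖u‖ := by gcongr
    _ = (|t.1 0| + |t.1 1|) * ‖u‖ := by ring

/-- The Lipschitz bound of the height. -/
theorem abs_hgt_le (t : Con) (u : Fin 2 → ℝ) : |hgt t u| ≤ (|t.1 0| + |t.1 1|) / |t.2.1| * ‖u‖ := by
  by_cases hc : t.2.1 = 0
  · simp only [hgt, hc, div_zero, abs_zero, zero_mul, le_refl]
  · rw [hgt, abs_div, abs_neg, div_mul_eq_mul_div, div_le_div_iff_of_pos_right (abs_pos.2 hc)]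
    exact abs_blin_le t u

/-! ### The cone fibres -/

section ConeFibre

variable {J : ℕ} (g : Fin J → Con) (v₀ : Fin 2 → ℝ)

/-- The active bottom constraints (bounding `w` from below). -/
def bots : Finset (Fin J) := (act g v₀).filter fun j => 0 < (g j).2.1

/-- The active top constraints (bounding `w` from above). -/
def tops : Finset (Fin J) := (act g v₀).filter fun j => (g j).2.1 < 0

/-- The active vertical constraints admit the base displacement `u`. -/
def vert (u : Fin 2 → ℝ) : Prop := ∀ j ∈ act g v₀, (g j).2.1 = 0 → 0 < blin (g j) u

/-- The fibre of the open local cone over the base displacement `u`. -/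
def Kfib (u : Fin 2 → ℝ) : Set ℝ := {t | ∀ j ∈ act g v₀, 0 < clin (g j) (u, t)}

/-- Membership in `bots`. -/
theorem mem_bots {j : Fin J} : j ∈ bots g v₀ ↔ j ∈ act g v₀ ∧ 0 < (g j).2.1 := by simp [bots]

/-- Membership in `tops`. -/
theorem mem_tops {j : Fin J} : j ∈ tops g v₀ ↔ j ∈ act g v₀ ∧ (g j).2.1 < 0 := by simp [tops]

/-- The largest bottom height. -/
def hlo (hB : (bots g v₀).Nonempty) (u : Fin 2 → ℝ) : ℝ := (bots g v₀).sup' hB fun j => hgt (g j) u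

/-- The least top height. -/
def hhi (hT : (tops g v₀).Nonempty) (u : Fin 2 → ℝ) : ℝ := (tops g v₀).inf' hT fun j => hgt (g j) u

/-- `hlo` is continuous. -/
theorem continuous_hlo (hB : (bots g v₀).Nonempty) : Continuous (hlo g v₀ hB) :=
  Continuous.finset_sup'_apply hB fun j _ => continuous_hgt (g j)

/-- `hhi` is continuous. -/
theorem continuous_hhi (hT : (tops g v₀).Nonempty) : Continuous (hhi g v₀ hT) :=
  Continuous.finset_inf'_apply hT fun j _ => continuous_hgt (g j)

/-- `hlo` is positively homogeneous. -/
theorem hlo_smul (hB : (bots g v₀).Nonempty) {s : ℝ} (hs : 0 ≤ s) (u : Fin 2 → ℝ) :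
    hlo g v₀ hB (s • u) = s * hlo g v₀ hB u := by
  unfold hlo
  simp only [hgt_smul]
  refine le_antisymm (Finset.sup'_le _ _ fun j hj => mul_le_mul_of_nonneg_left
    (Finset.le_sup' (fun j => hgt (g j) u) hj) hs) ?_
  obtain ⟨j, hj, heq⟩ := Finset.exists_mem_eq_sup' hB fun j => hgt (g j) u
  rw [heq]
  exact Finset.le_sup' (fun j => s * hgt (g j) u) hj

/-- `hhi` is positively homogeneous. -/
theorem hhi_smul (hT : (tops g v₀).Nonempty) {s : ℝ} (hs : 0 ≤ s) (u : Fin 2 → ℝ) :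
    hhi g v₀ hT (s • u) = s * hhi g v₀ hT u := by
  unfold hhi
  simp only [hgt_smul]
  refine le_antisymm ?_ ((Finset.le_inf'_iff _ _).2 fun j hj => mul_le_mul_of_nonneg_left
    (Finset.inf'_le (fun j => hgt (g j) u) hj) hs)
  obtain ⟨j, hj, heq⟩ := Finset.exists_mem_eq_inf' hT fun j => hgt (g j) u
  rw [heq]
  exact Finset.inf'_le (fun j => s * hgt (g j) u) hj

/-- **The cone fibre is the interval between the largest bottom height and the least top
height**, when the vertical constraints admit `u`; otherwise it is empty. -/
theorem mem_Kfib_iff (hB : (bots g v₀).Nonempty) (hT : (tops g v₀).Nonempty) (u : Fin 2 → ℝ)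
    (t : ℝ) : t ∈ Kfib g v₀ u ↔ hlo g v₀ hB u < t ∧ t < hhi g v₀ hT u ∧ vert g v₀ u := by
  unfold Kfib hlo hhi vert
  rw [Finset.sup'_lt_iff, Finset.lt_inf'_iff]
  constructor
  · intro h
    refine ⟨fun j hj => ?_, fun j hj => ?_, fun j hj hc => ?_⟩
    · obtain ⟨hja, hc⟩ := (mem_bots g v₀).1 hj
      have := h j hja
      rw [clin_eq_mul_sub _ _ _ hc.ne'] at this
      have := (mul_pos_iff_of_pos_left hc).1 this
      linarith
    · obtain ⟨hja, hc⟩ := (mem_tops g v₀).1 hj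
      have := h j hja
      rw [clin_eq_mul_sub _ _ _ hc.ne] at this
      have : t - hgt (g j) u < 0 := by
        by_contra hge
        push Not at hge
        have := mul_nonpos_of_nonpos_of_nonneg hc.le hge
        linarith
      linarith
    · have := h j hj
      rwa [clin_eq, hc, zero_mul, add_zero] at this
  · rintro ⟨h1, h2, h3⟩ j hj
    rcases lt_trichotomy 0 ((g j).2.1) with hc | hc | hc
    · rw [clin_eq_mul_sub _ _ _ hc.ne']
      exact mul_pos hc (by linarith [h1 j ((mem_bots g v₀).2 ⟨hj, hc⟩)])
    · rw [clin_eq, ← hc, zero_mul, add_zero]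
      exact h3 j hj hc.symm
    · rw [clin_eq_mul_sub _ _ _ hc.ne]
      exact mul_pos_of_neg_of_neg hc (by linarith [h2 j ((mem_tops g v₀).2 ⟨hj, hc⟩)])

/-- The cone fibre over an admissible base displacement. -/
theorem Kfib_eq_Ioo (hB : (bots g v₀).Nonempty) (hT : (tops g v₀).Nonempty) {u : Fin 2 → ℝ}
    (hv : vert g v₀ u) : Kfib g v₀ u = Ioo (hlo g v₀ hB u) (hhi g v₀ hT u) := by
  ext t
  rw [mem_Kfib_iff g v₀ hB hT, mem_Ioo]
  tauto

/-- A non-empty cone fibre lies over an admissible base displacement. -/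
theorem vert_of_nonempty {u : Fin 2 → ℝ} (hne : (Kfib g v₀ u).Nonempty) : vert g v₀ u := by
  obtain ⟨t, ht⟩ := hne
  intro j hj hc
  have := ht j hj
  rwa [clin_eq, hc, zero_mul, add_zero] at this

/-- A non-empty cone fibre is a non-degenerate interval. -/
theorem hlo_lt_hhi_of_nonempty (hB : (bots g v₀).Nonempty) (hT : (tops g v₀).Nonempty)
    {u : Fin 2 → ℝ} (hne : (Kfib g v₀ u).Nonempty) : hlo g v₀ hB u < hhi g v₀ hT u := by
  obtain ⟨t, ht⟩ := hne
  obtain ⟨h1, h2, -⟩ := (mem_Kfib_iff g v₀ hB hT u t).1 ht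
  exact h1.trans h2

/-- **The cone fibres have length `O(‖u‖)`.** -/
theorem Kfib_subset (hB : (bots g v₀).Nonempty) (hT : (tops g v₀).Nonempty) :
    ∃ M > 0, ∀ u : Fin 2 → ℝ, Kfib g v₀ u ⊆ Ioo (-(M * ‖u‖)) (M * ‖u‖) := by
  obtain ⟨jb, hjb⟩ := id hB
  obtain ⟨jt, hjt⟩ := id hT
  set Mb := (|(g jb).1 0| + |(g jb).1 1|) / |(g jb).2.1| with hMb
  set Mt := (|(g jt).1 0| + |(g jt).1 1|) / |(g jt).2.1| with hMt
  refine ⟨Mb + Mt + 1, by positivity, fun u t ht => ?_⟩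
  obtain ⟨h1, h2, -⟩ := (mem_Kfib_iff g v₀ ⟨jb, hjb⟩ ⟨jt, hjt⟩ u t).1 ht
  have hlo_ge : hgt (g jb) u ≤ hlo g v₀ ⟨jb, hjb⟩ u := Finset.le_sup' (fun j => hgt (g j) u) hjb
  have hhi_le : hhi g v₀ ⟨jt, hjt⟩ u ≤ hgt (g jt) u := Finset.inf'_le (fun j => hgt (g j) u) hjt
  have hb := abs_hgt_le (g jb) u
  have htt := abs_hgt_le (g jt) u
  rw [abs_le] at hb htt
  have hn := norm_nonneg u
  constructor
  · nlinarith [hb.1, div_nonneg (by positivity : 0 ≤ |(g jt).1 0| + |(g jt).1 1|) (abs_nonneg (g jt).2.1)]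
  · nlinarith [htt.2, div_nonneg (by positivity : 0 ≤ |(g jb).1 0| + |(g jb).1 1|) (abs_nonneg (g jb).2.1)]

/-- **The vertical fibres near a rim point on the pole plane are the cone fibres.** -/
theorem fib_eq_Kfib (hB : (bots g v₀).Nonempty) (hT : (tops g v₀).Nonempty)
    (hbd : Bornology.IsBounded (Om3 g))
    (hcl : ((v₀, 0) : (Fin 2 → ℝ) × ℝ) ∈ closure (Om3 g))
    (hZ : ∀ w : ℝ, ((v₀, w) : (Fin 2 → ℝ) × ℝ) ∈ closure (Om3 g) → w = 0) :
    ∃ δ₁ > 0, ∀ u : Fin 2 → ℝ, ‖u‖ < δ₁ → fib (Om3 g) (v₀ + u) = Kfib g v₀ u := by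
  have h0 := cval_nonneg_of_mem_closure g hcl
  obtain ⟨r₀, hr₀, hiff⟩ := mem_Om3_iff_act g v₀ h0
  -- small fibres: the gap lemma for the closed cell away from the window `|w| < r₀/2`
  obtain ⟨δ, hδ, hgap⟩ := exists_gap hbd.isCompact_closure (T := {w : ℝ | r₀ / 2 ≤ |w|})
    (isClosed_le continuous_const continuous_abs) v₀ (fun w hw hmem => by
      have := hZ w hmem
      subst this
      simp only [mem_setOf_eq, abs_zero] at hw
      linarith)
  obtain ⟨M, hM, hKM⟩ := Kfib_subset g v₀ hB hT
  refine ⟨min δ (r₀ / (2 * (M + 1))), lt_min hδ (by positivity), fun u hu => ?_⟩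
  have huδ : ‖u‖ < δ := hu.trans_le (min_le_left _ _)
  have huM : ‖u‖ < r₀ / (2 * (M + 1)) := hu.trans_le (min_le_right _ _)
  have hur : ‖u‖ < r₀ / 2 := by
    refine huM.trans_le ?_
    rw [div_le_div_iff_of_pos_left hr₀ (by positivity) (by positivity)]
    nlinarith
  -- the window equivalence
  have hwin : ∀ t : ℝ, |t| < r₀ / 2 → (t ∈ fib (Om3 g) (v₀ + u) ↔ t ∈ Kfib g v₀ u) := by
    intro t ht
    have hnorm : ‖((u, t) : (Fin 2 → ℝ) × ℝ)‖ < r₀ := by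
      rw [Prod.norm_def, Real.norm_eq_abs]
      exact max_lt (by linarith) (by linarith)
    have := hiff (u, t) hnorm
    rw [show ((v₀, 0) : (Fin 2 → ℝ) × ℝ) + (u, t) = (v₀ + u, t) by simp] at this
    exact this
  ext t
  constructor
  · intro ht
    refine (hwin t ?_).1 ht
    by_contra hge
    push Not at hge
    have := hgap (v₀ + u, t) (subset_closure ht) hge
    simp only [add_sub_cancel_left] at this
    linarith
  · intro ht
    refine (hwin t ?_).2 ht
    have := hKM u ht
    rw [mem_Ioo, ← abs_lt] at this
    calc |t| < M * ‖u‖ := this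
      _ ≤ M * (r₀ / (2 * (M + 1))) := mul_le_mul_of_nonneg_left huM.le hM.le
      _ ≤ r₀ / 2 := by
          rw [mul_div_assoc', div_le_div_iff₀ (by positivity) (by positivity)]
          nlinarith

/-- **Closed cone points lie above the pole plane** when the closed cell does. -/
theorem snd_nonneg_of_active_nonneg (hcl : ((v₀, 0) : (Fin 2 → ℝ) × ℝ) ∈ closure (Om3 g))
    (hup : ∀ p ∈ closure (Om3 g), 0 ≤ p.2) (q : (Fin 2 → ℝ) × ℝ)
    (hq : ∀ j ∈ act g v₀, 0 ≤ clin (g j) q) : 0 ≤ q.2 := by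
  obtain ⟨r₁, hr₁, hc⟩ := closure_of_active_nonneg g v₀ hcl
  by_cases hq0 : q = 0
  · simp [hq0]
  · have hqn : 0 < ‖q‖ := norm_pos_iff.2 hq0
    set s := r₁ / (2 * ‖q‖) with hs
    have hs0 : 0 < s := by positivity
    have hnorm : ‖s • q‖ < r₁ := by
      have : s * ‖q‖ = r₁ / 2 := by rw [hs]; field_simp
      rw [norm_smul, Real.norm_eq_abs, abs_of_pos hs0, this]
      linarith
    have hmem := hc (s • q) hnorm (fun j hj => by rw [clin_smul]; exact mul_nonneg hs0.le (hq j hj))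
    have := hup _ hmem
    simp only [Prod.snd_add, Prod.smul_snd, smul_eq_mul, zero_add] at this
    exact (mul_nonneg_iff_of_pos_left hs0).1 this

/-- **A non-empty cone fibre starts at a non-negative height** when the closed cell lies above the
pole plane. -/
theorem hlo_nonneg (hB : (bots g v₀).Nonempty) (hT : (tops g v₀).Nonempty)
    (hcl : ((v₀, 0) : (Fin 2 → ℝ) × ℝ) ∈ closure (Om3 g))
    (hup : ∀ p ∈ closure (Om3 g), 0 ≤ p.2) {u : Fin 2 → ℝ} (hne : (Kfib g v₀ u).Nonempty) :
    0 ≤ hlo g v₀ hB u := by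
  have hv := vert_of_nonempty g v₀ hne
  have hlt := hlo_lt_hhi_of_nonempty g v₀ hB hT hne
  refine snd_nonneg_of_active_nonneg g v₀ hcl hup (u, hlo g v₀ hB u) fun j hj => ?_
  rcases lt_trichotomy 0 ((g j).2.1) with hc | hc | hc
  · rw [clin_eq_mul_sub _ _ _ hc.ne']
    refine mul_nonneg hc.le ?_
    have := Finset.le_sup' (fun j => hgt (g j) u) ((mem_bots g v₀).2 ⟨hj, hc⟩)
    exact sub_nonneg.2 this
  · rw [clin_eq, ← hc, zero_mul, add_zero]
    exact (hv j hj hc.symm).le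
  · rw [clin_eq_mul_sub _ _ _ hc.ne]
    refine mul_nonneg_of_nonpos_of_nonpos hc.le ?_
    have := Finset.inf'_le (fun j => hgt (g j) u) ((mem_tops g v₀).2 ⟨hj, hc⟩)
    exact sub_nonpos.2 (hlt.le.trans this)

end ConeFibre

end SepThree

/-- **The vertical fibres near a rim point on the pole plane are the cone fibres** (registered part
of `stub_separateThreeZero`; literal form of `SepThree.fib_eq_Kfib`): if `(v₀, 0)` lies in the
closure of the bounded open polyhedral cell `Ω` and is the only point of the closure on its vertical
line, then for base displacements `u` small enough the vertical fibre of `Ω` over `v₀ + u` is the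
set of `t` at which every constraint active at `(v₀, 0)` has positive linear part at `(u, t)`. -/
theorem separateThree_fibres {J : ℕ} (g : Fin J → (Fin 2 → ℝ) × ℝ × ℝ) (v₀ : Fin 2 → ℝ) (hB : (SepThree.bots g v₀).Nonempty) (hT : (SepThree.tops g v₀).Nonempty) (hbd : Bornology.IsBounded (SepThree.Om3 g)) (hcl : ((v₀, 0) : (Fin 2 → ℝ) × ℝ) ∈ closure (SepThree.Om3 g)) (hZ : ∀ w : ℝ, ((v₀, w) : (Fin 2 → ℝ) × ℝ) ∈ closure (SepThree.Om3 g) → w = 0) : ∃ δ₁ > 0, ∀ u : Fin 2 → ℝ, ‖u‖ < δ₁ → {t : ℝ | ((v₀ + u, t) : (Fin 2 → ℝ) × ℝ) ∈ SepThree.Om3 g} = {t : ℝ | ∀ j ∈ SepThree.act g v₀, 0 < SepThree.clin (g j) (u, t)} := by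
  exact SepThree.fib_eq_Kfib g v₀ hB hT hbd hcl hZ

end Summit.KontsevichZagierPeriods.ArrangementNormalForm.JanusBands
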